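import Summits.BirchSwinnertonDyer.BirchSwinnertonDyer.Theorems.Rank2Observatory2DescClVCover
import Mathlib.RingTheory.Ideal.Norm.AbsNorm
import Mathlib.NumberTheory.RamificationInertia.Basic
import HarnessLib

/-!
# BirchSwinnertonDyer — rank ≥ 2 observatory: class-group-general 2-descent, glue lemmas (N6)

HONEST FRAMING: per-curve certified theorems and census instruments; no claim on BSD in rank ≥ 2.

Generic glue for the per-field registries and per-curve files of the KERNEL-2DESC-CL instrument
(design `b2b-bsdr2-cert-1/KERNEL-2DESC-CL.md`): small facts about prime ideals of `𝓞 K`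
(valuation `1` off the ideal, coprime rational integers, distinctness of explicitly presented primes,
the norm of an element lies in every prime containing it, prime divisors of an explicit prime-power
product), the monotonicity of the "classes of ideals containing `N`" subgroup in `N`, and the **valuation-parity functional** used in the independence
certificates (a square has even valuation everywhere). Sorry-free; axioms `propext`,
`Classical.choice`, `Quot.sound`.
[cite: Cassels1991LecturesEllipticCurves, §15] [cite: Marcus2018, Ch. 3]
-/

-- single-conjunct summit: `Summit.BirchSwinnertonDyer.BirchSwinnertonDyer.…` repeats the name by design
set_option linter.dupNamespace false

noncomputable section

open scoped Classical NumberField nonZeroDivisors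

open IsDedekindDomain IsDedekindDomain.HeightOneSpectrum NumberField Ideal

namespace Summit.BirchSwinnertonDyer.BirchSwinnertonDyer.Rank2Observatory.TwoDescCl

variable {K : Type*} [Field K] [NumberField K]

/-! ## Membership and valuations -/

/-- `x ∉ w ⟹ v_w(x) = 1` for an algebraic integer `x`. [folklore] -/
theorem valuation_eq_one_of_not_mem (w : HeightOneSpectrum (𝓞 K)) {x : 𝓞 K}
    (hx : x ∉ w.asIdeal) : w.valuation K (x : K) = 1 := by
  rw [RingOfIntegers.coe_eq_algebraMap]
  exact (valuation_eq_one_iff_notMem (v := w) (K := K)).mpr hx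

/-- Units lie in no prime: `log v_w(u) = 0`. [folklore] -/
theorem log_valuation_units_eq_zero (u : (𝓞 K)ˣ) (w : HeightOneSpectrum (𝓞 K)) :
    WithZero.log (w.valuation K ((u : 𝓞 K) : K)) = 0 :=
  Literature.NumberTheory.NumberFields.log_valuation_eq_zero_of_not_mem w
    (fun h => w.isPrime.ne_top (Ideal.eq_top_of_isUnit_mem _ h u.isUnit))

omit [NumberField K] in
/-- **A rational integer in a prime above `p` is divisible by `p`.** [folklore] -/
theorem dvd_of_intCast_mem (w : HeightOneSpectrum (𝓞 K)) {p : ℕ} (hp : p.Prime)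
    (hpw : (p : 𝓞 K) ∈ w.asIdeal) {m : ℤ} (hm : (m : 𝓞 K) ∈ w.asIdeal) : (p : ℤ) ∣ m := by
  by_contra hnd
  have hg : Int.gcd (p : ℤ) m = 1 := by
    rw [Int.gcd_eq_natAbs, Int.natAbs_natCast]
    exact (Nat.Prime.coprime_iff_not_dvd hp).mpr (fun h => hnd (Int.natCast_dvd.mpr h))
  obtain ⟨a, b, hab⟩ := Int.isCoprime_iff_gcd_eq_one.mpr hg
  have h1 : ((a * p + b * m : ℤ) : 𝓞 K) ∈ w.asIdeal := by
    push_cast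
    exact add_mem (Ideal.mul_mem_left _ _ hpw) (Ideal.mul_mem_left _ _ hm)
  rw [hab, Int.cast_one] at h1
  exact w.isPrime.ne_top ((Ideal.eq_top_iff_one _).mpr h1)

omit [NumberField K] in
/-- **Distinctness of explicitly presented primes**: `x ∈ w`, `y ∈ w'`, `y − x = m ∈ ℤ` with
`p ∤ m` and `p ∈ w` force `w ≠ w'`. (Used for `(p, α − r) ≠ (p, α − r')`, `r ≢ r' (mod p)`.)
[folklore] -/
theorem ne_of_sub_eq_intCast {w w' : HeightOneSpectrum (𝓞 K)} {p : ℕ} (hp : p.Prime)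
    (hpw : (p : 𝓞 K) ∈ w.asIdeal) {x y : 𝓞 K} (hx : x ∈ w.asIdeal) (hy : y ∈ w'.asIdeal) {m : ℤ}
    (hxy : y - x = (m : 𝓞 K)) (hm : ¬ (p : ℤ) ∣ m) : w ≠ w' := by
  rintro rfl
  have h : (m : 𝓞 K) ∈ w.asIdeal := hxy ▸ sub_mem hy hx
  exact hm (dvd_of_intCast_mem w hp hpw h)

omit [NumberField K] in
/-- Primes in distinct rational fibres are distinct: `p ∈ w`, `q ∈ w'`, `p ∤ q`. [folklore] -/
theorem ne_of_natCast_mem {w w' : HeightOneSpectrum (𝓞 K)} {p q : ℕ} (hp : p.Prime)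
    (hpw : (p : 𝓞 K) ∈ w.asIdeal) (hq : (q : 𝓞 K) ∈ w'.asIdeal) (hpq : ¬ p ∣ q) : w ≠ w' := by
  rintro rfl
  have h : ((q : ℤ) : 𝓞 K) ∈ w.asIdeal := by rwa [Int.cast_natCast]
  exact hpq (Int.natCast_dvd_natCast.mp (dvd_of_intCast_mem w hp hpw h))

omit [NumberField K] in
/-- `p ∈ w`, `p ∤ q` ⟹ `q ∉ w`. [folklore] -/
theorem not_natCast_mem_of_not_dvd (w : HeightOneSpectrum (𝓞 K)) {p q : ℕ} (hp : p.Prime)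
    (hpw : (p : 𝓞 K) ∈ w.asIdeal) (hpq : ¬ p ∣ q) : (q : 𝓞 K) ∉ w.asIdeal :=
  fun hq => ne_of_natCast_mem hp hpw hq hpq rfl

/-- Primes of different norm are distinct. [folklore] -/
theorem ne_of_absNorm_ne {w w' : HeightOneSpectrum (𝓞 K)}
    (h : absNorm w.asIdeal ≠ absNorm w'.asIdeal) : w ≠ w' := by
  rintro rfl
  exact h rfl

/-- **`x ∈ w ⟹ |N(x)| ∈ w`.** [cite: Marcus2018, Ch. 3, Thm. 22] -/
theorem natAbs_norm_mem (w : HeightOneSpectrum (𝓞 K)) {x : 𝓞 K} (hx : x ∈ w.asIdeal) :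
    (((Algebra.norm ℤ x).natAbs : ℕ) : 𝓞 K) ∈ w.asIdeal := by
  have h := Ideal.absNorm_mem (span {x} : Ideal (𝓞 K))
  rw [Ideal.absNorm_span_singleton] at h
  exact (Ideal.span_singleton_le_iff_mem _).mpr hx h

omit [NumberField K] in
/-- **A non-zero natural number in a prime `w` has a prime FACTOR in `w`.** [folklore] -/
theorem exists_prime_dvd_natCast_mem (w : HeightOneSpectrum (𝓞 K)) {n : ℕ} (hn : n ≠ 0)
    (h : (n : 𝓞 K) ∈ w.asIdeal) : ∃ q : ℕ, q.Prime ∧ q ∣ n ∧ (q : 𝓞 K) ∈ w.asIdeal := by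
  have key : ∀ L : List ℕ, (∀ q ∈ L, q.Prime) → ((L.prod : ℕ) : 𝓞 K) ∈ w.asIdeal →
      ∃ q ∈ L, q.Prime ∧ (q : 𝓞 K) ∈ w.asIdeal := by
    intro L
    induction L with
    | nil =>
      intro _ h1
      rw [List.prod_nil, Nat.cast_one] at h1
      exact absurd ((Ideal.eq_top_iff_one _).mpr h1) w.isPrime.ne_top
    | cons q L ih =>
      intro hL h1
      rw [List.prod_cons, Nat.cast_mul] at h1
      rcases w.isPrime.mem_or_mem h1 with h2 | h2
      · exact ⟨q, List.mem_cons_self, hL q List.mem_cons_self, h2⟩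
      · obtain ⟨q', hq', hp', hm'⟩ := ih (fun q' hq' => hL q' (List.mem_cons_of_mem q hq')) h2
        exact ⟨q', List.mem_cons_of_mem q hq', hp', hm'⟩
  obtain ⟨q, hqL, hq, hmem⟩ := key n.primeFactorsList
    (fun q hq => Nat.prime_of_mem_primeFactorsList hq) (by rwa [Nat.prod_primeFactorsList hn])
  exact ⟨q, hq, Nat.dvd_of_mem_primeFactorsList hqL, hmem⟩

/-- **`x ∈ w ⟹ some prime factor of `|N(x)|` lies in `w`.** [cite: Marcus2018, Ch. 3, Thm. 22] -/
theorem exists_prime_dvd_norm_mem (w : HeightOneSpectrum (𝓞 K)) {x : 𝓞 K} (hx0 : x ≠ 0)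
    (hx : x ∈ w.asIdeal) :
    ∃ q : ℕ, q.Prime ∧ q ∣ (Algebra.norm ℤ x).natAbs ∧ (q : 𝓞 K) ∈ w.asIdeal :=
  exists_prime_dvd_natCast_mem w
    (Int.natAbs_ne_zero.mpr (Algebra.norm_ne_zero_iff.mpr hx0)) (natAbs_norm_mem w hx)

/-- A prime dividing an explicit product of prime powers is one of the listed primes. [folklore] -/
theorem exists_eq_of_prime_dvd_prod_pow {k : ℕ} (P e : Fin k → ℕ) (hP : ∀ i, (P i).Prime) {q : ℕ}
    (hq : q.Prime) (h : q ∣ ∏ i, P i ^ e i) : ∃ i, q = P i := by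
  obtain ⟨i, _, hi⟩ := (Nat.Prime.prime hq).exists_mem_finset_dvd h
  exact ⟨i, (Nat.prime_dvd_prime_iff_eq hq (hP i)).mp (hq.dvd_of_dvd_pow hi)⟩

/-! ## `primesOver` bookkeeping -/

/-- The inertia degree read off the norm: `N(P) = p ^ f ⟹ f_P = f`. [cite: Marcus2018, Ch. 3, Thm. 22] -/
theorem inertiaDeg_eq_of_absNorm_eq {p : ℕ} (hp : p.Prime) {P : Ideal (𝓞 K)}
    (hP : P ∈ primesOver (span {(p : ℤ)}) (𝓞 K)) {f : ℕ} (h : absNorm P = p ^ f) :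
    P.inertiaDeg ℤ = f := by
  haveI : P.IsPrime := hP.1
  haveI : P.LiesOver (span {(p : ℤ)}) := hP.2
  have h1 := Ideal.pow_inertiaDeg p P
  rw [h] at h1
  exact Nat.pow_right_injective hp.two_le h1

/-! ## The `N`-support subgroup is monotone in `N` -/

/-- If every ideal containing `N` contains `M`, the classes of ideals containing `N` generate a
subgroup contained in the one for `M`. [folklore] -/
theorem closure_tsupp_le {N M : 𝓞 K} (h : ∀ J : Ideal (𝓞 K), N ∈ J → M ∈ J) :
    Subgroup.closure {c : ClassGroup (𝓞 K) | ∃ (J : Ideal (𝓞 K)) (hJ : J ∈ (Ideal (𝓞 K))⁰),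
        N ∈ J ∧ ClassGroup.mk0 ⟨J, hJ⟩ = c} ≤
      Subgroup.closure {c : ClassGroup (𝓞 K) | ∃ (J : Ideal (𝓞 K)) (hJ : J ∈ (Ideal (𝓞 K))⁰),
        M ∈ J ∧ ClassGroup.mk0 ⟨J, hJ⟩ = c} :=
  Subgroup.closure_mono fun _ ⟨J, hJ, hN, hc⟩ => ⟨J, hJ, h J hN, hc⟩

/-- **Generation transfers along divisibility**: if the classes of the ideals containing `N`
generate `Cl(K)` and `N ∣ M`, so do the classes of the ideals containing `M`. [folklore] -/
theorem closure_tsupp_eq_top_of_dvd {N M : 𝓞 K} (hdvd : N ∣ M)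
    (hN : Subgroup.closure {c : ClassGroup (𝓞 K) | ∃ (J : Ideal (𝓞 K)) (hJ : J ∈ (Ideal (𝓞 K))⁰),
        N ∈ J ∧ ClassGroup.mk0 ⟨J, hJ⟩ = c} = ⊤) :
    Subgroup.closure {c : ClassGroup (𝓞 K) | ∃ (J : Ideal (𝓞 K)) (hJ : J ∈ (Ideal (𝓞 K))⁰),
        M ∈ J ∧ ClassGroup.mk0 ⟨J, hJ⟩ = c} = ⊤ := by
  obtain ⟨c, rfl⟩ := hdvd
  exact top_le_iff.mp (hN ▸ closure_tsupp_le fun J hJ => Ideal.mul_mem_right _ _ hJ)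

/-! ## The valuation-parity functional -/

/-- **A square has even valuation**: for a family of non-zero integers `w` and the bit vector
`bit i = (ord_v (w i) is odd)`, every sub-product that is a square in `K` has an even number of
odd bits. (The parity functional of the independence certificates.) [cite: Cassels1991LecturesEllipticCurves, §15] -/
theorem even_card_of_isSquare_valuation {ι : Type*} (v : HeightOneSpectrum (𝓞 K)) (w : ι → 𝓞 K)
    (hw : ∀ i, w i ≠ 0) (bit : ι → Bool)
    (hbit : ∀ i, bit i = true ↔ ¬ (2 : ℤ) ∣ WithZero.log (v.valuation K (w i : K)))
    {T : Finset ι} (hsq : IsSquare (∏ i ∈ T, (w i : K))) :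
    Even (T.filter (fun i => bit i = true)).card := by
  have hne : ∀ x : K, x ≠ 0 → v.valuation K x ≠ 0 := fun x hx => (Valuation.ne_zero_iff _).mpr hx
  obtain ⟨r, hr⟩ := hsq
  have hT0 : (∏ i ∈ T, (w i : K)) ≠ 0 :=
    Finset.prod_ne_zero_iff.mpr fun i _ => RingOfIntegers.coe_ne_zero_iff.mpr (hw i)
  have hr0 : r ≠ 0 := by
    rintro rfl
    rw [mul_zero] at hr
    exact hT0 hr
  have key := congrArg (fun x => WithZero.log (v.valuation K x)) hr
  rw [map_mul, WithZero.log_mul (hne _ hr0) (hne _ hr0),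
    log_valuation_prod v T _ (fun i _ => RingOfIntegers.coe_ne_zero_iff.mpr (hw i))] at key
  have heven : Even (∑ i ∈ T, WithZero.log (v.valuation K (w i : K))) :=
    ⟨WithZero.log (v.valuation K r), key⟩
  rw [even_sum_iff_even_card_filter_odd] at heven
  convert heven using 2
  refine Finset.filter_congr fun i _ => ?_
  rw [hbit i, ← even_iff_two_dvd, Int.not_even_iff_odd]

/-- **Support form of the `T`-unit property**: if every prime containing `x` contains `M`, then
`x` is a unit at every prime not containing `M`. [folklore] -/
theorem valuation_eq_one_of_support (x M : 𝓞 K)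
    (hsupp : ∀ v : HeightOneSpectrum (𝓞 K), x ∈ v.asIdeal → M ∈ v.asIdeal)
    (v : HeightOneSpectrum (𝓞 K)) (hv : M ∉ v.asIdeal) : v.valuation K (x : K) = 1 :=
  valuation_eq_one_of_not_mem v fun h => hv (hsupp v h)

omit [NumberField K] in
/-- **Support from a divisibility certificate**: `x · δ = a ^ k` puts the support of `x` inside that
of `a`. [folklore] -/
theorem mem_of_mul_eq_pow {x δ a : 𝓞 K} {k : ℕ} (h : x * δ = a ^ k) (v : HeightOneSpectrum (𝓞 K))
    (hx : x ∈ v.asIdeal) : a ∈ v.asIdeal := by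
  have h1 : a ^ k ∈ v.asIdeal := h ▸ Ideal.mul_mem_right _ _ hx
  exact v.isPrime.mem_of_pow_mem k h1

omit [NumberField K] in
/-- Support inside two rational fibres from `x · δ = (p · q) ^ k`: a prime containing `x` contains
`p` or `q`. [folklore] -/
theorem natCast_mem_or_of_mul_eq_pow {x δ : 𝓞 K} {p q k : ℕ}
    (h : x * δ = ((p * q : ℕ) : 𝓞 K) ^ k) (v : HeightOneSpectrum (𝓞 K)) (hx : x ∈ v.asIdeal) :
    (p : 𝓞 K) ∈ v.asIdeal ∨ (q : 𝓞 K) ∈ v.asIdeal := by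
  have h1 := mem_of_mul_eq_pow h v hx
  rw [Nat.cast_mul] at h1
  exact v.isPrime.mem_or_mem h1

end Summit.BirchSwinnertonDyer.BirchSwinnertonDyer.Rank2Observatory.TwoDescCl

end
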